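import Literature.Computability.QuantumComplexity.ZOmegaCramer
import Literature.LinearAlgebra.TensorNetworks.JunctionTreeFP
import HarnessLib

/-!
# `ℤ[ω]` on codes: the coded semiring of the junction-tree engine for Clifford+`T` networks

Companion to `ZOmegaCramer.lean` (`ZOmega`: pairs `p + qω` of Gaussian integers, a commutative
ring with the embedding `val : ℤ[ω] →+* ℂ`, and the coefficient norm `cn` with `cn_add_le`,
`cn_mul_le : cn (xy) ≤ 4 cn x cn y`) and `Literature/LinearAlgebra/TensorNetworks/JunctionTreeFP.lean`
(`JT.CodeRing eR ν K cR`: the hypotheses under which the junction-tree evaluation over a semiring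
runs in polynomial time on codes). We code `x : ℤ[ω]` by its four integer coordinates
`((p.re, p.im), (q.re, q.im))` in the difference-pair integer code (`zoE`), realise `+` and `·`
on codes (`zoAddFP`, `zoMulFP`: `(p + qω)(p' + q'ω) = (pp' + i qq') + (pq' + qp')ω`), and prove
**`codeRing_zo : JT.CodeRing zoE cn 4 32`** (`sizeMeasure_cn`; code length and coefficient size
control each other linearly).

## References

* [MarkovShi2008] I. L. Markov, Y. Shi, SIAM J. Comput. 38 (2008) 963–981, §4 (Thm 4.6: exact
  arithmetic of the contraction).
* S. Arora, B. Barak, *Computational Complexity*, CUP 2009, §1.3.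
-/

namespace Literature.Computability.QuantumComplexity

namespace ZOmega

open Literature.Computability.Complexity Literature.Computability.Complexity.CodeFP
  Literature.Computability.Complexity.Brick Literature.LinearAlgebra.TensorNetworks.JT

/-- **The code of an element of `ℤ[ω]`**: its four integer coordinates. [folklore] -/
def zoE : ZOmega → List Bool := fun x => pairE (pairE intE intE) (pairE intE intE) ((x.p.re, x.p.im), (x.q.re, x.q.im))

/-- The coordinates on codes. [folklore] -/
theorem coordsFP : CodeFP zoE (pairE (pairE intE intE) (pairE intE intE)) (fun x => ((x.p.re, x.p.im), (x.q.re, x.q.im))) :=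
  ⟨_root_.id, PolyTimeComputable.id _, fun _ => rfl⟩

/-- Assembling an element from its coordinates on codes. [folklore] -/
theorem mkFP : CodeFP (pairE (pairE intE intE) (pairE intE intE)) zoE (fun c => (⟨⟨c.1.1, c.1.2⟩, ⟨c.2.1, c.2.2⟩⟩ : ZOmega)) :=
  ⟨_root_.id, PolyTimeComputable.id _, fun _ => rfl⟩

/-- **Addition in `ℤ[ω]` on codes.** [cite: AroraBarak2009, §1.3] -/
theorem zoAddFP : CodeFP (pairE zoE zoE) zoE (fun p => p.1 + p.2) := by
  have hc := (coordsFP.comp (fst zoE zoE)).pair (coordsFP.comp (snd zoE zoE))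
  -- the four sums
  have h1 := intAdd.comp (hc.fst'.fst'.fst'.pair hc.snd'.fst'.fst')
  have h2 := intAdd.comp (hc.fst'.fst'.snd'.pair hc.snd'.fst'.snd')
  have h3 := intAdd.comp (hc.fst'.snd'.fst'.pair hc.snd'.snd'.fst')
  have h4 := intAdd.comp (hc.fst'.snd'.snd'.pair hc.snd'.snd'.snd')
  refine ((mkFP.comp ((h1.pair h2).pair (h3.pair h4))).congr fun p => ?_)
  obtain ⟨x, y⟩ := p
  show (⟨⟨x.p.re + y.p.re, x.p.im + y.p.im⟩, ⟨x.q.re + y.q.re, x.q.im + y.q.im⟩⟩ : ZOmega) = x + y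
  cases x; cases y; rfl

/-- **Multiplication in `ℤ[ω]` on codes**: `(p + qω)(p' + q'ω) = (pp' + i qq') + (pq' + qp')ω`.
[cite: AroraBarak2009, §1.3] -/
theorem zoMulFP : CodeFP (pairE zoE zoE) zoE (fun p => p.1 * p.2) := by
  have hc := (coordsFP.comp (fst zoE zoE)).pair (coordsFP.comp (snd zoE zoE))
  -- coordinates: x.p = a + b i, x.q = e + f i, y.p = c' + d i, y.q = g + h i
  have ha := hc.fst'.fst'.fst'
  have hb := hc.fst'.fst'.snd'
  have he := hc.fst'.snd'.fst'
  have hf := hc.fst'.snd'.snd'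
  have hc' := hc.snd'.fst'.fst'
  have hd := hc.snd'.fst'.snd'
  have hg := hc.snd'.snd'.fst'
  have hh := hc.snd'.snd'.snd'
  have mul := fun {f g : ZOmega × ZOmega → ℤ} (hf : CodeFP (pairE zoE zoE) intE f) (hg : CodeFP (pairE zoE zoE) intE g) =>
    intMul.comp (hf.pair hg)
  have add := fun {f g : ZOmega × ZOmega → ℤ} (hf : CodeFP (pairE zoE zoE) intE f) (hg : CodeFP (pairE zoE zoE) intE g) =>
    intAdd.comp (hf.pair hg)
  have sub := fun {f g : ZOmega × ZOmega → ℤ} (hf : CodeFP (pairE zoE zoE) intE f) (hg : CodeFP (pairE zoE zoE) intE g) =>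
    intSub.comp (hf.pair hg)
  -- p'.re = ac' - bd - (eh + fg); p'.im = ad + bc' + (eg - fh); q'.re = ag - bh + ec' - fd; q'.im = ah + bg + ed + fc'
  have hpre := sub (sub (mul ha hc') (mul hb hd)) (add (mul he hh) (mul hf hg))
  have hpim := add (add (mul ha hd) (mul hb hc')) (sub (mul he hg) (mul hf hh))
  have hqre := sub (add (sub (mul ha hg) (mul hb hh)) (mul he hc')) (mul hf hd)
  have hqim := add (add (add (mul ha hh) (mul hb hg)) (mul he hd)) (mul hf hc')
  refine ((mkFP.comp ((hpre.pair hpim).pair (hqre.pair hqim))).congr fun p => ?_)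
  obtain ⟨x, y⟩ := p
  refine ZOmega.ext (Zsqrtd.ext ?_ ?_) (Zsqrtd.ext ?_ ?_) <;>
    simp [mul_p, mul_q, Zsqrtd.re_mul, Zsqrtd.im_mul, gi] <;> ring

/-! ### The size measure and the coded ring -/

/-- `cn` is a size measure with constant `4`. [folklore] -/
theorem sizeMeasure_cn : SizeMeasure cn 4 where
  zero := cn_zero
  one := cn_one.le
  add := cn_add_le
  mul := cn_mul_le
  one_le := by norm_num

/-- Each coordinate is bounded by `cn`. [folklore] -/
theorem natAbs_coords_le (x : ZOmega) :
    x.p.re.natAbs ≤ cn x ∧ x.p.im.natAbs ≤ cn x ∧ x.q.re.natAbs ≤ cn x ∧ x.q.im.natAbs ≤ cn x := by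
  unfold cn
  refine ⟨?_, ?_, ?_, ?_⟩ <;> simp

/-- The code is short when the coefficients are small: `|zoE x| ≤ 32·size (cn x) + 32`. [folklore] -/
theorem length_zoE_le (x : ZOmega) : (zoE x).length ≤ 32 * Nat.size (cn x) + 32 := by
  obtain ⟨h1, h2, h3, h4⟩ := natAbs_coords_le x
  have e1 := length_dpEnc_le x.p.re
  have e2 := length_dpEnc_le x.p.im
  have e3 := length_dpEnc_le x.q.re
  have e4 := length_dpEnc_le x.q.im
  have s1 := Nat.size_le_size h1
  have s2 := Nat.size_le_size h2
  have s3 := Nat.size_le_size h3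
  have s4 := Nat.size_le_size h4
  simp only [zoE, pairE_apply, length_boolPair, intE]
  omega

/-- The coefficients are small when the code is short: `size (cn x) ≤ |zoE x|`. [folklore] -/
theorem size_cn_le (x : ZOmega) : Nat.size (cn x) ≤ 32 * (zoE x).length + 32 := by
  have e1 := size_natAbs_le_length_intE x.p.re
  have e2 := size_natAbs_le_length_intE x.p.im
  have e3 := size_natAbs_le_length_intE x.q.re
  have e4 := size_natAbs_le_length_intE x.q.im
  have hcn : Nat.size (cn x) ≤ max (max (Nat.size x.p.re.natAbs) (Nat.size x.p.im.natAbs))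
      (max (Nat.size x.q.re.natAbs) (Nat.size x.q.im.natAbs)) := by
    unfold cn
    rcases max_cases (max x.p.re.natAbs x.p.im.natAbs) (max x.q.re.natAbs x.q.im.natAbs) with ⟨h, _⟩ | ⟨h, _⟩ <;>
      rw [h] <;> [rcases max_cases x.p.re.natAbs x.p.im.natAbs with ⟨h', _⟩ | ⟨h', _⟩;
        rcases max_cases x.q.re.natAbs x.q.im.natAbs with ⟨h', _⟩ | ⟨h', _⟩] <;> rw [h'] <;> simp
  simp only [zoE, pairE_apply, length_boolPair, intE] at *
  have := max_le_iff.1 (le_refl (max (max (Nat.size x.p.re.natAbs) (Nat.size x.p.im.natAbs))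
      (max (Nat.size x.q.re.natAbs) (Nat.size x.q.im.natAbs))))
  omega

/-- **`ℤ[ω]` is a coded semiring** for the junction-tree engine (`K = 4`, `cR = 32`). [folklore] -/
theorem codeRing_zo : CodeRing zoE cn 4 32 where
  size := sizeMeasure_cn
  add := zoAddFP
  mul := zoMulFP
  len_le := length_zoE_le
  size_le := size_cn_le

end ZOmega

end Literature.Computability.QuantumComplexity
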